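import Mathlib
import Summits.Schanuel.Schanuel.Theorems.RigidCoreMinimalCounterexampleInAclMateGrowth
import Summits.Schanuel.Schanuel.Theorems.RigidCoreMinimalCounterexampleInAclMateGrowthBounds

/-!
# Mates of a rank-2 first failure, III: the escape is VERTICAL — crux stmt-Schanuel-0969

Route `RigidCore`, crux (S*) `MinimalCounterexampleInAcl` (item stmt-Schanuel-0969), line `kernel-arithmetic-selection`
(lead prover-line-stmt-Schanuel-0969-c6-0), landed `--supports stmt-Schanuel-0969`.  This makes IMPORTABLE the analytic toolkit of
the crux disprover's work file `Cruxes/MinimalCounterexampleInAcl/DisproofRankTwo.lean` (refuter-cdisprove-stmt-Schanuel-0969-g4,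
§18–§19; adapted verbatim up to spelling out its two helper definitions as local notation), on which the gen-19 skeleton's
SECOND-LEVEL SELECTION stubs rest (growth of the coefficients of a second-level relation along the mates).

`abs_re_le_of_expPoly_eq_zero` (`|Re s| ≤ log (max 1 (C (1+‖s‖)^D))` on the large zeros of `m(e^s, s)`),
`norm_lt_of_expPoly_eq_zero_of_im_le` (zeros with `|Im s| ≤ T` are bounded), `locusPts_finite_of_im_bounded`
(**locus points with bounded imaginary parts are FINITE**), `exists_large_im_of_infinite`,
`exp_coord_polynomially_bounded` (**exponentials of large locus points are polynomially bounded above and below**):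
infinitely many mates of a rank-2 first failure force VERTICAL ESCAPE `|Im x'ᵢ| → ∞` with `|Re x'ᵢ| = O(log |x'ᵢ|)`.

Notation (local, no definitions): `expPoly[m, s] = MvPolynomial.aeval ![cexp s, s] m`.

## References

* [Lindemann1882] F. Lindemann, *Über die Zahl π*, Math. Ann. 20 (1882) (tree `transcendental_exp_holds`).
* [Polya1920] G. Pólya, *Geometrisches über die Verteilung der Nullstellen gewisser ganzer transzendenter
  Funktionen*, Münch. Sitzungsber. 50 (1920) (zeros of exponential polynomials lie in logarithmic strips).
-/

noncomputable section

set_option linter.dupNamespace false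

open Complex Polynomial Set Filter Topology Bornology Finset
open Literature.NumberTheory.Transcendental
open Literature.NumberTheory.Transcendental.KernelTranslatesRankTwo (eval_map_finSuccEquiv
  finite_setOf_aeval_eq_zero exists_mvPolynomial_of_trdeg_lt_two)

-- adapted from Cruxes/MinimalCounterexampleInAcl/DisproofRankTwo.lean (refuter-cdisprove-stmt-Schanuel-0969-g4, rc 0)
namespace Summit.Schanuel.Schanuel.Cruxes.MinimalCounterexampleInAcl.KernelArithmeticSelection.MateGrowth

/-- The one-variable exponential polynomial `s ↦ m(e^s, s)` attached to `m ∈ ℚ[T, S]` (local notation, no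
definition: `expPoly[m, s]` is literally `MvPolynomial.aeval ![cexp s, s] m`). -/
local notation3 "expPoly[" m ", " s "]" => (MvPolynomial.aeval ![Complex.exp s, s] m : ℂ)

/-- A coefficient `c ∈ ℚ[S]` (as `MvPolynomial (Fin 1) ℚ`) viewed as a complex polynomial (local notation, no
definition). -/
local notation3 "coefC[" c "]" =>
  (Polynomial.map (algebraMap ℚ ℂ) (MvPolynomial.uniqueAlgEquiv ℚ (Fin 1) c) : Polynomial ℂ)

/-- **Vertical escape, packaged**: `|Re s| ≤ log (max 1 (C (1+‖s‖)^D))` for the large zeros. -/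
theorem abs_re_le_of_expPoly_eq_zero {m : MvPolynomial (Fin 2) ℚ} (hm : m ≠ 0) :
    ∃ R₀ C : ℝ, ∃ D : ℕ, 0 ≤ C ∧ ∀ s : ℂ, expPoly[m, s] = 0 → R₀ ≤ ‖s‖ →
      |s.re| ≤ Real.log (max 1 (C * (1 + ‖s‖) ^ D)) := by
  obtain ⟨R₁, C₁, D₁, hC₁, h₁⟩ := norm_exp_le_of_expPoly_eq_zero hm
  obtain ⟨R₂, C₂, D₂, hC₂, h₂⟩ := norm_exp_neg_le_of_expPoly_eq_zero hm
  refine ⟨max R₁ R₂, max C₁ C₂, max D₁ D₂, le_max_of_le_left hC₁, fun s hs hR => ?_⟩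
  have hP1 : 1 ≤ 1 + ‖s‖ := by linarith [norm_nonneg s]
  have hbig : ∀ (C : ℝ) (D : ℕ), 0 ≤ C → C ≤ max C₁ C₂ → D ≤ max D₁ D₂ →
      max 1 (C * (1 + ‖s‖) ^ D) ≤ max 1 (max C₁ C₂ * (1 + ‖s‖) ^ max D₁ D₂) := by
    intro C D hC hCle hDle
    refine max_le_max le_rfl ?_
    exact mul_le_mul hCle (pow_le_pow_right₀ hP1 hDle) (pow_nonneg (by linarith) _)
      (hC.trans hCle)
  have e1 : ‖cexp s‖ = Real.exp s.re := Complex.norm_exp s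
  have e2 : ‖cexp (-s)‖ = Real.exp (-s.re) := by rw [Complex.norm_exp]; simp
  have hr : Real.exp s.re ≤ max 1 (max C₁ C₂ * (1 + ‖s‖) ^ max D₁ D₂) := by
    rw [← e1]
    exact (h₁ s hs (le_trans (le_max_left _ _) hR)).trans (hbig C₁ D₁ hC₁ (le_max_left _ _) (le_max_left _ _))
  have hl : Real.exp (-s.re) ≤ max 1 (max C₁ C₂ * (1 + ‖s‖) ^ max D₁ D₂) := by
    rw [← e2]
    exact (h₂ s hs (le_trans (le_max_right _ _) hR)).trans (hbig C₂ D₂ hC₂ (le_max_right _ _) (le_max_right _ _))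
  have hpos : 0 < max 1 (max C₁ C₂ * (1 + ‖s‖) ^ max D₁ D₂) := lt_of_lt_of_le one_pos (le_max_left _ _)
  rw [abs_le]
  constructor
  · have := (Real.le_log_iff_exp_le hpos).2 hl
    linarith
  · exact (Real.le_log_iff_exp_le hpos).2 hr

/-- **Zeros with bounded imaginary part are bounded** ("escape is VERTICAL"): for each `T` there is
`R` with `‖s‖ < R` for every zero `s` of `m(e^s, s)` with `|Im s| ≤ T` (exp beats every polynomial). -/
theorem norm_lt_of_expPoly_eq_zero_of_im_le {m : MvPolynomial (Fin 2) ℚ} (hm : m ≠ 0) (T : ℝ) :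
    ∃ R : ℝ, ∀ s : ℂ, expPoly[m, s] = 0 → |s.im| ≤ T → ‖s‖ < R := by
  obtain ⟨R₀, C, D, hC, h⟩ := abs_re_le_of_expPoly_eq_zero hm
  -- `C (1+r)^D e^{-(r-T)} → 0`
  have ht0 : Tendsto (fun r : ℝ => (1 + r) ^ D * Real.exp (-(1 + r))) atTop (𝓝 0) :=
    (Real.tendsto_pow_mul_exp_neg_atTop_nhds_zero D).comp (tendsto_atTop_add_const_left atTop 1 tendsto_id)
  have ht : Tendsto (fun r : ℝ => C * Real.exp (1 + T) * ((1 + r) ^ D * Real.exp (-(1 + r)))) atTop (𝓝 0) := by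
    simpa using ht0.const_mul (C * Real.exp (1 + T))
  have hev : ∀ᶠ r in atTop, C * Real.exp (1 + T) * ((1 + r) ^ D * Real.exp (-(1 + r))) < 1 :=
    ht (Iio_mem_nhds one_pos)
  obtain ⟨R₁, hR₁⟩ := Filter.eventually_atTop.1 hev
  set R := max (max R₀ R₁) (T + 1) with hR
  refine ⟨R, fun s hs hT => ?_⟩
  by_contra hnot
  have hRs : R ≤ ‖s‖ := not_lt.1 hnot
  have hR0s : R₀ ≤ ‖s‖ := le_trans (le_trans (le_max_left _ _) (le_max_left _ _)) hRs
  have hR1s : R₁ ≤ ‖s‖ := le_trans (le_trans (le_max_right _ _) (le_max_left _ _)) hRs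
  have hTs : T + 1 ≤ ‖s‖ := le_trans (le_max_right _ _) hRs
  have hre := h s hs hR0s
  -- `‖s‖ - T ≤ |re s|`
  have hre_ge : ‖s‖ - T ≤ |s.re| := by
    have := Complex.norm_le_abs_re_add_abs_im s
    linarith
  have hpos : 0 < max 1 (C * (1 + ‖s‖) ^ D) := lt_of_lt_of_le one_pos (le_max_left _ _)
  have hexp : Real.exp (‖s‖ - T) ≤ max 1 (C * (1 + ‖s‖) ^ D) := by
    have h1 : Real.exp |s.re| ≤ max 1 (C * (1 + ‖s‖) ^ D) := by
      rwa [← Real.le_log_iff_exp_le hpos]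
    exact (Real.exp_le_exp.2 hre_ge).trans h1
  -- but exp beats the polynomial at `‖s‖ ≥ R₁`
  have hsmall := hR₁ ‖s‖ hR1s
  have hgt1 : 1 < Real.exp (‖s‖ - T) := by
    rw [← Real.exp_zero]; exact Real.exp_lt_exp.2 (by linarith)
  rcases le_max_iff.1 hexp with h1 | h2
  · linarith
  · -- `exp(‖s‖-T) ≤ C (1+‖s‖)^D` contradicts `C e^{1+T} (1+‖s‖)^D e^{-(1+‖s‖)} < 1`
    have hkey : C * (1 + ‖s‖) ^ D = (C * Real.exp (1 + T) * ((1 + ‖s‖) ^ D * Real.exp (-(1 + ‖s‖)))) *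
        Real.exp (‖s‖ - T) := by
      have e : Real.exp (1 + T) * Real.exp (-(1 + ‖s‖)) * Real.exp (‖s‖ - T) = 1 := by
        rw [← Real.exp_add, ← Real.exp_add, show 1 + T + -(1 + ‖s‖) + (‖s‖ - T) = 0 by ring,
          Real.exp_zero]
      calc C * (1 + ‖s‖) ^ D = C * (1 + ‖s‖) ^ D * (Real.exp (1 + T) * Real.exp (-(1 + ‖s‖)) * Real.exp (‖s‖ - T)) := by
            rw [e, mul_one]
        _ = _ := by ring
    have hposexp : 0 < Real.exp (‖s‖ - T) := Real.exp_pos _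
    have : C * (1 + ‖s‖) ^ D < 1 * Real.exp (‖s‖ - T) := by
      rw [hkey]; exact mul_lt_mul_of_pos_right hsmall hposexp
    linarith


/-- **§19 HEADLINE — LOCUS POINTS WITH BOUNDED IMAGINARY PARTS ARE FINITE (rank 2).**  For `x ∈ ℂ²`
with `trdeg ℚ(x, eˣ) < 2`, the tuples `v ∈ 𝒵_W` with `|Im vᵢ| ≤ T` for both `i` form a finite set: the
only way to infinitely many mates is VERTICAL ESCAPE `|Im x'ᵢ| → ∞` for some `i`. -/
theorem locusPts_finite_of_im_bounded {x : Fin 2 → ℂ}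
    (htr : Algebra.trdeg ℚ ↥(IntermediateField.adjoin ℚ (Set.range x ∪ Set.range (cexp ∘ x))) < (2 : Cardinal))
    (T : ℝ) :
    {v : Fin 2 → ℂ | (∀ i, |(v i).im| ≤ T) ∧ ∀ p : MvPolynomial (Fin 2 ⊕ Fin 2) ℚ,
        MvPolynomial.aeval (Sum.elim x (cexp ∘ x)) p = 0 →
        MvPolynomial.aeval (Sum.elim v (cexp ∘ v)) p = 0}.Finite := by
  choose m hm0 hm using fun i => exists_coord_expPoly htr i
  choose R hR using fun i => norm_lt_of_expPoly_eq_zero_of_im_le (hm0 i) T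
  refine (locusPts_bounded_finite htr (max (R 0) (R 1))).subset fun v hv => ⟨fun i => ?_, hv.2⟩
  have hlt := hR i (v i) (hm i v hv.2) (hv.1 i)
  fin_cases i
  · exact hlt.le.trans (le_max_left _ _)
  · exact hlt.le.trans (le_max_right _ _)

/-- … so an INFINITE family of locus points (e.g. infinitely many mates of a rank-2 first failure) has
UNBOUNDED imaginary parts. -/
theorem exists_large_im_of_infinite {x : Fin 2 → ℂ}
    (htr : Algebra.trdeg ℚ ↥(IntermediateField.adjoin ℚ (Set.range x ∪ Set.range (cexp ∘ x))) < (2 : Cardinal))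
    {M : Set (Fin 2 → ℂ)} (hinf : M.Infinite)
    (hM : ∀ v ∈ M, ∀ p : MvPolynomial (Fin 2 ⊕ Fin 2) ℚ,
        MvPolynomial.aeval (Sum.elim x (cexp ∘ x)) p = 0 →
        MvPolynomial.aeval (Sum.elim v (cexp ∘ v)) p = 0) (T : ℝ) :
    ∃ v ∈ M, ∃ i, T < |(v i).im| := by
  by_contra h
  push Not at h
  exact hinf ((locusPts_finite_of_im_bounded htr T).subset fun v hv => ⟨h v hv, hM v hv⟩)

/-- **Exponentials of large locus points are polynomially bounded above and below** (packaging §19 for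
the two coordinate exponential polynomials): there are `R₀, C, D` with
`max ‖e^{vᵢ}‖ ‖e^{-vᵢ}‖ ≤ max 1 (C (1+‖vᵢ‖)^D)` for every `v ∈ 𝒵_W` and `i` with `‖vᵢ‖ ≥ R₀`. -/
theorem exp_coord_polynomially_bounded {x : Fin 2 → ℂ}
    (htr : Algebra.trdeg ℚ ↥(IntermediateField.adjoin ℚ (Set.range x ∪ Set.range (cexp ∘ x))) < (2 : Cardinal)) :
    ∃ R₀ C : ℝ, ∃ D : ℕ, ∀ v : Fin 2 → ℂ, (∀ p : MvPolynomial (Fin 2 ⊕ Fin 2) ℚ,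
        MvPolynomial.aeval (Sum.elim x (cexp ∘ x)) p = 0 →
        MvPolynomial.aeval (Sum.elim v (cexp ∘ v)) p = 0) →
      ∀ i, R₀ ≤ ‖v i‖ → max ‖cexp (v i)‖ ‖cexp (-(v i))‖ ≤ max 1 (C * (1 + ‖v i‖) ^ D) := by
  choose m hm0 hm using fun i => exists_coord_expPoly htr i
  choose R₁ C₁ D₁ hC₁ h₁ using fun i => norm_exp_le_of_expPoly_eq_zero (hm0 i)
  choose R₂ C₂ D₂ hC₂ h₂ using fun i => norm_exp_neg_le_of_expPoly_eq_zero (hm0 i)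
  set R₀ := max (max (R₁ 0) (R₁ 1)) (max (R₂ 0) (R₂ 1))
  set C := max (max (C₁ 0) (C₁ 1)) (max (C₂ 0) (C₂ 1))
  set D := max (max (D₁ 0) (D₁ 1)) (max (D₂ 0) (D₂ 1))
  refine ⟨R₀, C, D, fun v hv i hR => ?_⟩
  have hP1 : 1 ≤ 1 + ‖v i‖ := by linarith [norm_nonneg (v i)]
  have hmono : ∀ (C' : ℝ) (D' : ℕ), 0 ≤ C' → C' ≤ C → D' ≤ D →
      max 1 (C' * (1 + ‖v i‖) ^ D') ≤ max 1 (C * (1 + ‖v i‖) ^ D) := by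
    intro C' D' hC' hC'le hD'le
    refine max_le_max le_rfl ?_
    exact mul_le_mul hC'le (pow_le_pow_right₀ hP1 hD'le) (pow_nonneg (by linarith) _) (hC'.trans hC'le)
  have hz := hm i v hv
  refine max_le ?_ ?_
  · have hR₁ : R₁ i ≤ ‖v i‖ := by
      refine le_trans ?_ hR
      fin_cases i
      · exact le_trans (le_max_left _ _) (le_max_left _ _)
      · exact le_trans (le_max_right _ _) (le_max_left _ _)
    refine (h₁ i (v i) hz hR₁).trans (hmono _ _ (hC₁ i) ?_ ?_)
    · fin_cases i
      · exact le_trans (le_max_left _ _) (le_max_left _ _)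
      · exact le_trans (le_max_right _ _) (le_max_left _ _)
    · fin_cases i
      · exact le_trans (le_max_left _ _) (le_max_left _ _)
      · exact le_trans (le_max_right _ _) (le_max_left _ _)
  · have hR₂ : R₂ i ≤ ‖v i‖ := by
      refine le_trans ?_ hR
      fin_cases i
      · exact le_trans (le_max_left _ _) (le_max_right _ _)
      · exact le_trans (le_max_right _ _) (le_max_right _ _)
    refine (h₂ i (v i) hz hR₂).trans (hmono _ _ (hC₂ i) ?_ ?_)
    · fin_cases i
      · exact le_trans (le_max_left _ _) (le_max_right _ _)
      · exact le_trans (le_max_right _ _) (le_max_right _ _)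
    · fin_cases i
      · exact le_trans (le_max_left _ _) (le_max_right _ _)
      · exact le_trans (le_max_right _ _) (le_max_right _ _)

/-! ## Registered stub (crux stmt-Schanuel-0969, line `kernel-arithmetic-selection`, gen 19 toolkit) -/

/-- **Registered stub `stub_expCoordPolynomiallyBounded` (PROVED)** — exponentials of large locus points of a rank-2 tuple with
`trdeg ℚ(x, eˣ) < 2` are polynomially bounded ABOVE AND BELOW (uncurried form of `exp_coord_polynomially_bounded`). -/
theorem stub_expCoordPolynomiallyBounded : ∀ (x : Fin 2 → ℂ), Algebra.trdeg ℚ ↥(IntermediateField.adjoin ℚ (Set.range x ∪ Set.range (Complex.exp ∘ x))) < (2 : Cardinal) → ∃ R₀ C : ℝ, ∃ D : ℕ, ∀ v : Fin 2 → ℂ, (∀ p : MvPolynomial (Fin 2 ⊕ Fin 2) ℚ, MvPolynomial.aeval (Sum.elim x (Complex.exp ∘ x)) p = 0 → MvPolynomial.aeval (Sum.elim v (Complex.exp ∘ v)) p = 0) → ∀ i, R₀ ≤ ‖v i‖ → max ‖Complex.exp (v i)‖ ‖Complex.exp (-(v i))‖ ≤ max 1 (C * (1 + ‖v i‖) ^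 D) :=
  fun _ htr => exp_coord_polynomially_bounded htr

end Summit.Schanuel.Schanuel.Cruxes.MinimalCounterexampleInAcl.KernelArithmeticSelection.MateGrowth

end
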